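import Literature.MathematicalPhysics.QuantumFieldTheory.Balaban1983to89.B9Thm312WholeLeft
import Literature.MathematicalPhysics.QuantumFieldTheory.Balaban1983to89.B9Thm313Whole

/-!
# `Balaban1983to89.B9Thm313WholeLeft` — [B9] Theorem 3.13 (p. 426), II: the LEFT sup entry (3.42)₂ of 𝔊 (∇_U𝔊) AT ONE MEMBER, from
# the reduction (3.153) differentiated on the left and two letters through a Hölder-class block norm

T. Bałaban, *Propagators for lattice gauge theories in a background field*, Commun. Math. Phys. **99** (1985) 389–434
[`Balaban1985BackgroundPropagators`, "B9"]; [4] = T. Bałaban, *Propagators and renormalization transformations for lattice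
gauge theories. II*, Commun. Math. Phys. **96** (1984) 223–250 [`Balaban1984PropagatorsII`].

statement-level skeleton of published theorems with citation tags; proofs where landed; nothing here is a claim about the
Yang–Mills mass gap

THE PRINTED LOCI (verbatim).  p. 426: *"The formulas (3.147), (3.153) permit us to reduce properties of the operators 𝔓, 𝔊 to the
corresponding properties of the operators G′, (Q′G′²Q′*)⁻¹, G₁, (QG₁Q*)⁻¹"*; (3.152) p. 426: *"RD*G₁DR = R, RD*G₁𝒳 = RG′D*𝒳"*; (3.153)
p. 426: *"𝔊 = G₁ − G₁DRD*G₁ − G₁Q*(QG₁Q*)⁻¹QG₁ = G₁𝔓* = 𝔓G₁"*; Theorem 3.13 p. 426: *"If an external gauge field configuration U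
satisfies the regularity conditions (3.35), (3.36) for α₀ sufficiently small, then Theorems 3.3, 3.10, 3.11 hold for the propagator
𝔊, with the exception of the inequality in (3.42) involving the covariant Laplace operator."*; (3.42)₂ p. 397: *"|(∇_UG′(U)λ)(x)| ≦
B₀L^jη·e^{−δ₀d(y,y′)}|λ|"*; (3.43) p. 398 (the Hölder entries ‖ζ∇_UG′λ‖_β, ‖ζG′∇*_Uλ‖_β ≦ B₀(β₀)(L^jη)^{1−β}(‖ζ‖_β + |ζ|)e^{−δ₀d}|λ|);
(3.44) p. 398 (the mixed entry |(∇_UG′∇*_Uλ)(x)| ≦ B′₀(ε)e^{−δ₀d(y,y′)}(‖λ‖_ε + |λ|)).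

THE POINT.  Seat n06-l's row-21 leaves (`…B9Thm313Whole.thm313Printed_of_step`, `…B9Thm312WholeLeafLeftGlob.thm313Printed_of_step_glob`)
prove (3.42)₁,₃ and (3.47)₀,₂ of 𝔊 and DISPLAY the two ∇_U𝔊 members.  Differentiating (3.153) on the left,
  ∇_U𝔊 = ∇_UG₁ − (∇_UG₁D)(RD*G₁) − (∇_UG₁Q*)((QG₁Q*)⁻¹QG₁),   ∇_UG₁𝒳 = ∇_UG₀𝒳 + (∇_UG₀(Δ′_π + Δ⁽²⁾_π))(G₁𝒳)  (𝒳 = I, D, Q*),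
every factor is in the tree (`B9Thm312WholeLeft.entry1_of_stepD` for ∇_UG₁, `…LeftStep.stepD1`, the right entries G₁D, G₁Q* of
`B9Thm313Whole`, its letters `rgd2`, `c1_2`, `q2`) EXCEPT the first factors ∇_UG₀Q* and ∇_UG₀D.  ∇_UG₀Q* is a (3.42)₂-type entry of G₀
on block-constant inputs (sup classes).  ∇_UG₀D is the MIXED entry (3.44) of G₀ — false between pure sup classes (Calderón–Zygmund;
cell GAPS C-pv21g2-1) and printed with HÖLDER data of its input; in (3.153) its input is RD*G₁λ = RG′D*λ ((3.152)), whose Hölder size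
is controlled by the SUP size of λ through (3.43) for G′ (md `SectD-sup-proof.md` Lemma 4.1 (L4)-h).  So the reduction is typed
with ONE FREE block norm `bH` on the scalar site fields (the Hölder class — abstract, the instance's) and two letters through it:
* §1 `Letters313D 𝔬 R₀ H₀ hG B₃ δ₃ bH U` (Prop structure, printed ∕ md shape, nothing asserted): `dgQs` (∇_UG₀Q* : Z⁰ → 𝔠_Y⁽¹⁾),
  `rgdH` (RD*G₁ : 𝔠⁽⁰⁾ → bH — (3.152) + (3.43) for G′ + (3.49)), `dgDH` (∇_UG₀D : bH → 𝔠_Y⁽¹⁾ — (3.44) for G₀ = md Lemma 4.3 (∇G));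
  `constD313` (the constant of ∇_U𝔊, with `_nonneg`, `_mono`).
* §2 `comp_fix_left_right` (∇_UA𝒳 = ∇_UG₀𝒳 + (∇_UG₀T)(A𝒳) from A = G₀ + G₀TA), `hasMaj_left_right` (its majorant form: one composition),
  ★ `GG_entry1_of_letters` — THEOREM 3.13, ENTRY (3.42)₂ FOR 𝔊 AT U, PRINTED SHAPE: |(∇_U𝔊λ)(x)| ≦ C·L^jη·e^{−ρ′d(y,y′)}|λ| with C =
  `constD313 …` and ρ′ + 3σ ≦ ρ ≦ min(δ₀, δ₃), ρ + σ ≦ δ_K — from `Thm33G0.e0`, `LeftStep` (e1, stepD1), `Step.step1` on 𝔠⁽²⁾, `Letters313`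
  (gD2, gQs2, rgd2, c1_2, q2), `Letters313D`, `Identities` ([4] (2.54) + (2.61) eight times).
The family theorem consuming it (row 21 with all three sup entries and all three global entries of 𝔊 proved inside) is the sequel
`…B9Thm313WholeLeafLeft`.

HONEST SCOPE.  Nothing of print is asserted: the letters are HYPOTHESES of printed ∕ md shape, `bH` is a free block norm (at the
instance: the covariant-Hölder block size of the md §2.6 with its smooth partition), and the derivation of `rgdH`, `dgDH` from
(3.43), (3.44), (3.49) is the md's Lemmas 4.1 ∕ 4.3, not typed; the content here is the algebra of (3.153) differentiated on the left and
its block-majorant bookkeeping.  NOT a node discharge, NOT summit progress; one finite lattice at a time; nothing continuum, nothing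
about the mass gap.  Cell `pub-ymgap` (HUMAN RULING D-0062), Track A node N06 [B9], N06-ASSIGNMENT v1 row 21 (bundle F7), seat
`pub-ymgap-dag-n06-l` (g2), 2026-08-27.
-/

namespace Literature.MathematicalPhysics.QuantumFieldTheory.Balaban1983to89.B9Thm313WholeLeft

open Literature.MathematicalPhysics.QuantumFieldTheory.Balaban1983to89
open Finset B6RandomWalk B6RandomWalkHom B9Thm34Ext B9Thm37GlueCor36 B11SectG B9SectDSup
open B9Thm37AllNorms B9Thm37AllNormsInstances B9FromB6 B9FromB6ModelSignsOn B9Thm312Whole B9Thm312WholeLeaf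
open B9Thm312WholeLeft B9Thm313Whole

noncomputable section

section OneMember

variable {g : B9.Geometry} {B : B9.Backgrounds} {X Y Z W : Type}
variable [Fintype X] [Fintype Y] [Fintype Z] [Fintype W] [Fintype g.Site]

/-! ## §1 The letters of the left entry of 𝔊 (printed ∕ md shape; nothing asserted) -/

/-- **THE LETTERS OF ∇_U𝔊's REDUCTION AT U** through a FREE block norm `bH` on the scalar site fields (the Hölder class of the
instance), constant B₃, rate δ₃ — hypotheses of printed ∕ md shape, nothing asserted: `dgQs` = ∇_UG₀Q* from the coarse fields
(class Z⁰, sup) into 𝔠_Y⁽¹⁾, |(∇_UG₀Q*b)(x)| ≦ B₃L^jη·e^{−δ₃d}|b| (Theorem 3.3's (3.42)₂ for G₀ on the block functions Q*b);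
`rgdH` = the letter RD*G₁ = RG′D* of (3.152) read INTO `bH`: size_{bH}(y; RD*G₁λ) ≦ B₃e^{−δ₃d(y,y′)}sup_{Δ(y′)}|λ| (Theorem 3.1's
Hölder entry (3.43) for G′ composed with (3.49) for R — md Lemma 4.1 (L4), h-part); `dgDH` = the MIXED entry ∇_UG₀D OUT OF `bH`:
(L^jη)⁻¹sup_{Δ(y)}|∇_UG₀Ds| ≦ B₃e^{−δ₃d(y,y′)}size_{bH}(y′; s) ((3.44) for G₀ with the Hölder data of s — md Lemma 4.3 (∇G); between
pure sup classes this bound is false, cell GAPS C-pv21g2-1, whence the free Hölder class).  The operator of `rgdH` is spelled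
`R ∘ D* ∘ G₁ ∘ id` as in `Letters313.rgd2`. [cite: Balaban1985BackgroundPropagators, Thm 3.13 p.426 + (3.152)–(3.153) p.426 + (3.42)–(3.44) pp.397–398 + (3.49) p.399] -/
structure Letters313D (𝔬 : Ops g B X Y Z W) (R₀ : ℝ) (H₀ : Prop) (hG : GeoOK g) (B₃ δ₃ : ℝ)
    (bH : BlockNorm (toB6 g R₀ H₀) (W → ℝ)) (U : B.Cfg) : Prop where
  dgQs : HasMaj (cNorm R₀ H₀ 𝔬.blkZ hG.lenle 0) (cNorm R₀ H₀ 𝔬.blkY hG.lenle 1) (𝔬.D U ∘ₗ 𝔬.G0 U ∘ₗ 𝔬.Qstar U)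
    (fun a b => B₃ * Real.exp (-(δ₃ * g.dist a b)))
  rgdH : HasMaj (cNorm R₀ H₀ 𝔬.blk hG.lenle 0) bH (𝔬.R U ∘ₗ 𝔬.Dvstar U ∘ₗ 𝔬.G1 U ∘ₗ LinearMap.id)
    (fun a b => B₃ * Real.exp (-(δ₃ * g.dist a b)))
  dgDH : HasMaj bH (cNorm R₀ H₀ 𝔬.blkY hG.lenle 1) (𝔬.D U ∘ₗ 𝔬.G0 U ∘ₗ 𝔬.Dv U)
    (fun a b => B₃ * Real.exp (-(δ₃ * g.dist a b)))

/-- The constant of ∇_U𝔊's sup entry as the reduction delivers it (all middle sup norms with cutting cost 1, the Hölder class with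
cost κ_H): C_L (the ∇_UG₁ constant) + κ_H·B₃²c (∇_UG₀D ∘ RD*G₁) + θ′(A₃B₃c)c ((∇_UG₀T₁)(G₁D)(RD*G₁)) + B₃(B₃(B₃A₁c)c)c (∇_UG₀Q* ∘ C₁QG₁) +
θ′(A₃(B₃(B₃A₁c)c)c)c ((∇_UG₀T₁)(G₁Q*)(C₁QG₁)). [cite: Balaban1985BackgroundPropagators, Thm 3.13 p.426 (bookkeeping)] -/
def constD313 (CL θ' A₁ A₃ B₃ κH c : ℝ) : ℝ :=
  CL + κH * B₃ * B₃ * c + θ' * (A₃ * B₃ * c) * c + B₃ * (B₃ * (B₃ * A₁ * c) * c) * c +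
    θ' * (A₃ * (B₃ * (B₃ * A₁ * c) * c) * c) * c

omit [Fintype X] [Fintype Y] [Fintype Z] [Fintype W] [Fintype g.Site] in
/-- `constD313` is non-negative for non-negative data. [cite: Balaban1985BackgroundPropagators, Thm 3.13 p.426 (bookkeeping)] -/
theorem constD313_nonneg {CL θ' A₁ A₃ B₃ κH c : ℝ} (hL : 0 ≤ CL) (hθ : 0 ≤ θ') (h₁ : 0 ≤ A₁) (h₃ : 0 ≤ A₃) (hB : 0 ≤ B₃)
    (hκ : 0 ≤ κH) (hc : 0 ≤ c) : 0 ≤ constD313 CL θ' A₁ A₃ B₃ κH c := by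
  unfold constD313
  positivity

omit [Fintype X] [Fintype Y] [Fintype Z] [Fintype W] [Fintype g.Site] in
/-- `constD313` is monotone in (C_L, θ′, A₁, A₃, κ_H) (for non-negative θ′, A₁, A₃, B₃, c). [cite: Balaban1985BackgroundPropagators, Thm 3.13 p.426 (bookkeeping)] -/
theorem constD313_mono {CL CL' θ' θ'' A₁ A₁' A₃ A₃' B₃ κH κH' c : ℝ} (hL' : CL ≤ CL') (hθ : 0 ≤ θ') (hθ'' : θ' ≤ θ'')
    (h₁ : 0 ≤ A₁) (h₁' : A₁ ≤ A₁') (h₃ : 0 ≤ A₃) (h₃' : A₃ ≤ A₃') (hB : 0 ≤ B₃) (hκ' : κH ≤ κH') (hc : 0 ≤ c) :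
    constD313 CL θ' A₁ A₃ B₃ κH c ≤ constD313 CL' θ'' A₁' A₃' B₃ κH' c := by
  unfold constD313
  have hθ''0 : 0 ≤ θ'' := hθ.trans hθ''
  have hA₃'0 : 0 ≤ A₃' := h₃.trans h₃'
  have e2 : κH * B₃ * B₃ * c ≤ κH' * B₃ * B₃ * c := by gcongr
  have e3 : θ' * (A₃ * B₃ * c) * c ≤ θ'' * (A₃' * B₃ * c) * c := by gcongr
  have e4 : B₃ * (B₃ * (B₃ * A₁ * c) * c) * c ≤ B₃ * (B₃ * (B₃ * A₁' * c) * c) * c := by gcongr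
  have e5 : θ' * (A₃ * (B₃ * (B₃ * A₁ * c) * c) * c) * c ≤ θ'' * (A₃' * (B₃ * (B₃ * A₁' * c) * c) * c) * c := by gcongr
  linarith

/-! ## §2 One member, one U: the left sup entry (3.42)₂ of 𝔊 -/

omit [Fintype X] [Fintype Y] [Fintype Z] [Fintype W] [Fintype g.Site] in
/-- **(3.130) ∕ (3.138) differentiated on the left, with a right factor**: A = G₀ + G₀TA gives ∇A𝒳 = ∇G₀𝒳 + (∇G₀T)(A𝒳).
[cite: Balaban1985BackgroundPropagators, (3.130) p.421 + (3.138) p.423] -/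
theorem comp_fix_left_right {F₀ : Type} [AddCommGroup F₀] [Module ℝ F₀] {G0 T A : Module.End ℝ (X → ℝ)}
    (Dop : (X → ℝ) →ₗ[ℝ] (Y → ℝ)) (F : F₀ →ₗ[ℝ] (X → ℝ)) (hfix : A = G0 + G0 ∘ₗ T ∘ₗ A) :
    Dop ∘ₗ A ∘ₗ F = Dop ∘ₗ G0 ∘ₗ F + (Dop ∘ₗ G0 ∘ₗ T) ∘ₗ (A ∘ₗ F) := by
  refine LinearMap.ext fun v => ?_
  have hpt : A (F v) = G0 (F v) + G0 (T (A (F v))) := by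
    conv_lhs => rw [hfix]
    simp only [LinearMap.add_apply, LinearMap.comp_apply]
  simp only [LinearMap.comp_apply, LinearMap.add_apply]
  conv_lhs => rw [hpt]
  rw [map_add]

/-- **The majorant form of `comp_fix_left_right`**: ∇G₀𝒳 : b₀ → 𝔠_Y⁽¹⁾ (a·e^{−ρ_a d}), ∇G₀T : 𝔠⁽²⁾ → 𝔠_Y⁽¹⁾ (θ′e^{−δ_K d}), A𝒳 : b₀ → 𝔠⁽²⁾
(A′e^{−ρ_A d}) and A = G₀ + G₀TA give ∇A𝒳 : b₀ → 𝔠_Y⁽¹⁾ the majorant (a + θ′A′c)e^{−rd} for 0 ≦ r ≦ min(ρ_a, ρ_A), r + σ ≦ δ_K (one use of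
[4] (2.54) + (2.61); the middle norm 𝔠⁽²⁾ has cutting cost 1). [cite: Balaban1985BackgroundPropagators, (3.130) p.421 + Thm 3.12 p.423; Balaban1984PropagatorsII, Lemma 2.1 p.234] -/
theorem hasMaj_left_right {F₀ : Type} [AddCommGroup F₀] [Module ℝ F₀] {R₀ : ℝ} {H₀ : Prop} (hG : GeoOK g)
    {blk : X → g.Site} {blkY : Y → g.Site} {b₀ : BlockNorm (toB6 g R₀ H₀) F₀}
    {G0 T A : Module.End ℝ (X → ℝ)} {Dop : (X → ℝ) →ₗ[ℝ] (Y → ℝ)} {Fop : F₀ →ₗ[ℝ] (X → ℝ)}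
    {θ' a A' δK ρa ρA r σ c : ℝ} (hrow : RowSum (toB6 g R₀ H₀) σ c) (hθ' : 0 ≤ θ') (ha : 0 ≤ a) (hA' : 0 ≤ A')
    (hr : 0 ≤ r) (hra : r ≤ ρa) (hrA : r ≤ ρA) (hrδ : r + σ ≤ δK)
    (hKD : HasMaj (cNorm R₀ H₀ blk hG.lenle 2) (cNorm R₀ H₀ blkY hG.lenle 1) (Dop ∘ₗ G0 ∘ₗ T)
      (fun a b => θ' * Real.exp (-(δK * g.dist a b))))
    (hEF : HasMaj b₀ (cNorm R₀ H₀ blkY hG.lenle 1) (Dop ∘ₗ G0 ∘ₗ Fop) (fun y y' => a * Real.exp (-(ρa * g.dist y y'))))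
    (hAF : HasMaj b₀ (cNorm R₀ H₀ blk hG.lenle 2) (A ∘ₗ Fop) (fun y y' => A' * Real.exp (-(ρA * g.dist y y'))))
    (hfix : A = G0 + G0 ∘ₗ T ∘ₗ A) :
    HasMaj b₀ (cNorm R₀ H₀ blkY hG.lenle 1) (Dop ∘ₗ A ∘ₗ Fop) (fun y y' => (a + θ' * A' * c) * Real.exp (-(r * g.dist y y'))) := by
  have htri : Triangle254 (toB6 g R₀ H₀) := fun a b c => hG.tri a b c
  have h2 : HasMaj b₀ (cNorm R₀ H₀ blkY hG.lenle 1) ((Dop ∘ₗ G0 ∘ₗ T) ∘ₗ (A ∘ₗ Fop))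
      (fun y y' => (cNorm R₀ H₀ blk hG.lenle 2 (X := X)).κ * θ' * A' * c * Real.exp (-(r * g.dist y y'))) :=
    hasMaj_comp_exp htri hG.dnn hrow hθ' hA' hr hrA hrδ hKD hAF
  simp only [cNorm_κ, one_mul] at h2
  have hsum := (hEF.of_rate_le hG.dnn ha hra).add h2
  rw [← comp_fix_left_right Dop Fop hfix] at hsum
  exact hsum.mono fun y y' => le_of_eq (by simp only [toB6_dist]; ring)

omit [Fintype Y] [Fintype g.Site] in
/-- **(3.153) DIFFERENTIATED ON THE LEFT**: ∇𝔊 = ∇G₁ − (∇G₁D)(RD*G₁) − (∇G₁Q*)((QG₁Q*)⁻¹(QG₁)) from 𝔊 = G₁𝔓* (`Identities.eq153`).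
[cite: Balaban1985BackgroundPropagators, (3.153) p.426] -/
theorem D_GG_eq {𝔬 : Ops g B X Y Z W} {U : B.Cfg} (hI : Identities 𝔬 U) :
    𝔬.D U ∘ₗ 𝔬.GG U =
      𝔬.D U ∘ₗ 𝔬.G1 U ∘ₗ LinearMap.id -
        (𝔬.D U ∘ₗ 𝔬.G1 U ∘ₗ 𝔬.Dv U) ∘ₗ (𝔬.R U ∘ₗ 𝔬.Dvstar U ∘ₗ 𝔬.G1 U ∘ₗ LinearMap.id) -
        (𝔬.D U ∘ₗ 𝔬.G1 U ∘ₗ 𝔬.Qstar U) ∘ₗ (𝔬.C1 U ∘ₗ (𝔬.Q U ∘ₗ (𝔬.G1 U ∘ₗ LinearMap.id))) := by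
  refine LinearMap.ext fun f => ?_
  simp only [LinearMap.comp_apply, LinearMap.sub_apply, LinearMap.id_coe, id_eq, hI.eq153, frakPstar_apply, map_sub]
  abel

/-- ★ **THEOREM 3.13, ENTRY (3.42)₂ FOR 𝔊, PRINTED SHAPE** — the reduction at U for ∇_U𝔊: from Theorem 3.3's (3.42)₁ (`he0`) and (3.42)₂
(`hLS.e1`) for G₀, the step K′₁ = G₀(Δ′_π + Δ⁽²⁾_π) on 𝔠⁽²⁾ (θe^{−δ_K d}, θc < 1) and its derivative (`hLS.stepD1`, θ′e^{−δ_K d}), the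
resolvent identity of (3.138), the letters `gD2`, `gQs2`, `rgd2`, `c1_2`, `q2` of `Letters313`, the letters `dgQs`, `rgdH`, `dgDH` of
`Letters313D` through the Hölder class `bH` (cutting cost κ_H), and (3.153): |(∇_U𝔊λ)(x)| ≦ C·L^jη·e^{−ρ′d(y,y′)}|λ| for x ∈ Δ(y), supp λ ⊂
Δ(y′), C = `constD313 (B₀ + θ′·B₀(1−θc)⁻¹·c) θ′ (B₀(1−θc)⁻¹) (B₃(1−θc)⁻¹) B₃ κ_H c`, for every ρ′ ≧ 0 with ρ′ + 3σ ≦ ρ (ρ ≦ δ₀, ρ ≦ δ₃, ρ + σ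
≦ δ_K).  Route: `D_GG_eq`; ∇_UG₁, ∇_UG₁D, ∇_UG₁Q* by `hasMaj_left_right`; eight compositions ([4] (2.54) + (2.61)).
[cite: Balaban1985BackgroundPropagators, Thm 3.13 p.426 + (3.152)–(3.153) p.426 + (3.138) p.423 + (3.42)–(3.44) pp.397–398] -/
theorem GG_entry1_of_letters {R₀ : ℝ} {H₀ : Prop} (hG : GeoOK g) {𝔬 : Ops g B X Y Z W} {U : B.Cfg}
    {bH : BlockNorm (toB6 g R₀ H₀) (W → ℝ)}
    {θ θ' B₀ B₃ δ₀ δ₃ δK ρ ρ' σ c : ℝ} (hrow : RowSum (toB6 g R₀ H₀) σ c) (hc : 0 ≤ c)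
    (hθ : 0 ≤ θ) (hθ' : 0 ≤ θ') (hB₀ : 0 ≤ B₀) (hB₃ : 0 ≤ B₃) (hσ : 0 ≤ σ) (hρ' : 0 ≤ ρ') (hρ'ρ : ρ' + 3 * σ ≤ ρ) (hρS : ρ ≤ δ₀)
    (hρ₃ : ρ ≤ δ₃) (hρδ : ρ + σ ≤ δK) (hq : θ * c < 1)
    (hK : HasMaj (cNorm R₀ H₀ 𝔬.blk hG.lenle 2) (cNorm R₀ H₀ 𝔬.blk hG.lenle 2) (𝔬.G0 U ∘ₗ (𝔬.Tpi U + 𝔬.T2 U))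
      (fun a b => θ * Real.exp (-(δK * g.dist a b))))
    (he0 : HasMajorant (g := toB6 g R₀ H₀) 𝔬.blk (𝔬.G0 U) (fun a b => B₀ * g.len a ^ 2 * Real.exp (-(δ₀ * g.dist a b))))
    (hLS : LeftStep 𝔬 R₀ H₀ hG.lenle B₀ δ₀ θ' δK U)
    (hL : Letters313 𝔬 R₀ H₀ hG B₃ δ₃ U) (hLD : Letters313D 𝔬 R₀ H₀ hG B₃ δ₃ bH U) (hI : Identities 𝔬 U) :
    HasMajorantHom (g := toB6 g R₀ H₀) 𝔬.blk 𝔬.blkY (𝔬.D U ∘ₗ 𝔬.GG U)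
      (fun a b => constD313 (B₀ + θ' * (B₀ * (1 - θ * c)⁻¹) * c) θ' (B₀ * (1 - θ * c)⁻¹) (B₃ * (1 - θ * c)⁻¹) B₃ bH.κ c *
        g.len a * Real.exp (-(ρ' * g.dist a b))) := by
  have hq1 : 0 ≤ (1 - θ * c)⁻¹ := inv_nonneg.mpr (by linarith)
  have hA₁ : 0 ≤ B₀ * (1 - θ * c)⁻¹ := mul_nonneg hB₀ hq1
  have hA₃ : 0 ≤ B₃ * (1 - θ * c)⁻¹ := mul_nonneg hB₃ hq1
  have hCL : 0 ≤ B₀ + θ' * (B₀ * (1 - θ * c)⁻¹) * c := add_nonneg hB₀ (mul_nonneg (mul_nonneg hθ' hA₁) hc)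
  have hfix1 := fix_of_inverses hI.invG0' hI.invG1
  have hρ0 : 0 ≤ ρ := by linarith
  have htri : Triangle254 (toB6 g R₀ H₀) := fun a b c => hG.tri a b c
  -- (a) the right entries of G₁: G₁ : 𝔠⁽⁰⁾ → 𝔠⁽²⁾, G₁D : W¹ → 𝔠⁽²⁾, G₁Q* : Z⁰ → 𝔠⁽²⁾ (as in `GG_entry0_of_letters`)
  have hG1 : HasMaj (cNorm R₀ H₀ 𝔬.blk hG.lenle 0) (cNorm R₀ H₀ 𝔬.blk hG.lenle 2) (𝔬.G1 U ∘ₗ LinearMap.id)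
      (fun a b => B₀ * (1 - θ * c)⁻¹ * Real.exp (-(ρ * g.dist a b))) := by
    rw [LinearMap.comp_id]
    exact hasMaj_entry0_cNorm hG hrow hθ hB₀ hρ0 hρS hρδ hK he0 hfix1 hq
  have hGD := hasMaj_right_of_step hG hrow hθ hB₃ hρ0 hρ₃ hρδ hK hL.gD2 hfix1 hq
  have hGQ := hasMaj_right_of_step hG hrow hθ hB₃ hρ0 hρ₃ hρδ hK hL.gQs2 hfix1 hq
  -- (b) the left-and-right entries ∇G₁ : 𝔠⁽⁰⁾ → 𝔠_Y⁽¹⁾, ∇G₁D : W¹ → 𝔠_Y⁽¹⁾, ∇G₁Q* : Z⁰ → 𝔠_Y⁽¹⁾, all at the rate ρ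
  have h10 : HasMaj (BlockNorm.ofBlocks (toB6 g R₀ H₀) 𝔬.blk) (BlockNorm.ofBlocks (toB6 g R₀ H₀) 𝔬.blkY) (𝔬.D U ∘ₗ 𝔬.G0 U)
      (fun a b => B₀ * g.len a * Real.exp (-(δ₀ * g.dist a b))) :=
    hasMaj_of_hasMajorantHom (G := toB6 g R₀ H₀) 𝔬.blk 𝔬.blkY
      (fun a b => mul_nonneg (mul_nonneg hB₀ (hG.lenle a)) (Real.exp_nonneg _)) hLS.e1
  have hE0 : HasMaj (cNorm R₀ H₀ 𝔬.blk hG.lenle 0) (cNorm R₀ H₀ 𝔬.blkY hG.lenle 1) (𝔬.D U ∘ₗ 𝔬.G0 U ∘ₗ LinearMap.id)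
      (fun a b => B₀ * Real.exp (-(δ₀ * g.dist a b))) := by
    rw [LinearMap.comp_id]
    refine (hasMaj_cNorm_of_hasMaj hG 1 0 h10).mono fun y y' => le_of_eq ?_
    have hy : g.len y ≠ 0 := (hG.lenpos y).ne'
    simp only [wt, pow_zero, pow_one, mul_one]
    rw [mul_assoc B₀, mul_comm (g.len y), ← mul_assoc B₀, mul_assoc, mul_inv_cancel₀ hy, mul_one]
  have hD1 : HasMaj (cNorm R₀ H₀ 𝔬.blk hG.lenle 0) (cNorm R₀ H₀ 𝔬.blkY hG.lenle 1) (𝔬.D U ∘ₗ 𝔬.G1 U ∘ₗ LinearMap.id)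
      (fun y y' => (B₀ + θ' * (B₀ * (1 - θ * c)⁻¹) * c) * Real.exp (-(ρ * g.dist y y'))) :=
    hasMaj_left_right hG hrow hθ' hB₀ hA₁ hρ0 hρS le_rfl hρδ hLS.stepD1 hE0 hG1 hfix1
  -- (c) TERM B = (∇G₁D)(RD*G₁) = (∇G₀D)(RD*G₁) + ((∇G₀T₁)(G₁D))(RD*G₁): the first summand through the Hölder class `bH`, the
  --     second through the sup class W¹ (letter `rgd2`)
  have hρ'₃ : ρ' ≤ δ₃ := by linarith
  have hρ'σ₃ : ρ' + σ ≤ δ₃ := by linarith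
  have hB1 : HasMaj (cNorm R₀ H₀ 𝔬.blk hG.lenle 0) (cNorm R₀ H₀ 𝔬.blkY hG.lenle 1)
      ((𝔬.D U ∘ₗ 𝔬.G0 U ∘ₗ 𝔬.Dv U) ∘ₗ (𝔬.R U ∘ₗ 𝔬.Dvstar U ∘ₗ 𝔬.G1 U ∘ₗ LinearMap.id))
      (fun y y' => bH.κ * B₃ * B₃ * c * Real.exp (-(ρ' * g.dist y y'))) :=
    hasMaj_comp_exp htri hG.dnn hrow hB₃ hB₃ hρ' hρ'₃ hρ'σ₃ hLD.dgDH hLD.rgdH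
  have hGDT : HasMaj (cNorm R₀ H₀ 𝔬.blkW hG.lenle 1) (cNorm R₀ H₀ 𝔬.blkY hG.lenle 1)
      ((𝔬.D U ∘ₗ 𝔬.G0 U ∘ₗ (𝔬.Tpi U + 𝔬.T2 U)) ∘ₗ (𝔬.G1 U ∘ₗ 𝔬.Dv U))
      (fun y y' => (cNorm R₀ H₀ 𝔬.blk hG.lenle 2 (X := X)).κ * θ' * (B₃ * (1 - θ * c)⁻¹) * c *
        Real.exp (-((ρ' + σ) * g.dist y y'))) :=
    hasMaj_comp_exp htri hG.dnn hrow hθ' hA₃ (by linarith) (by linarith) (by linarith) hLS.stepD1 hGD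
  simp only [cNorm_κ, one_mul] at hGDT
  have hθA₃ : 0 ≤ θ' * (B₃ * (1 - θ * c)⁻¹) * c := mul_nonneg (mul_nonneg hθ' hA₃) hc
  have hB2 : HasMaj (cNorm R₀ H₀ 𝔬.blk hG.lenle 0) (cNorm R₀ H₀ 𝔬.blkY hG.lenle 1)
      (((𝔬.D U ∘ₗ 𝔬.G0 U ∘ₗ (𝔬.Tpi U + 𝔬.T2 U)) ∘ₗ (𝔬.G1 U ∘ₗ 𝔬.Dv U)) ∘ₗ
        (𝔬.R U ∘ₗ 𝔬.Dvstar U ∘ₗ 𝔬.G1 U ∘ₗ LinearMap.id))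
      (fun y y' => (cNorm R₀ H₀ 𝔬.blkW hG.lenle 1 (X := W)).κ * (θ' * (B₃ * (1 - θ * c)⁻¹) * c) * B₃ * c *
        Real.exp (-(ρ' * g.dist y y'))) :=
    hasMaj_comp_exp htri hG.dnn hrow hθA₃ hB₃ hρ' hρ'₃ le_rfl hGDT hL.rgd2
  simp only [cNorm_κ, one_mul] at hB2
  have eB : (𝔬.D U ∘ₗ 𝔬.G1 U ∘ₗ 𝔬.Dv U) ∘ₗ (𝔬.R U ∘ₗ 𝔬.Dvstar U ∘ₗ 𝔬.G1 U ∘ₗ LinearMap.id) =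
      (𝔬.D U ∘ₗ 𝔬.G0 U ∘ₗ 𝔬.Dv U) ∘ₗ (𝔬.R U ∘ₗ 𝔬.Dvstar U ∘ₗ 𝔬.G1 U ∘ₗ LinearMap.id) +
        (((𝔬.D U ∘ₗ 𝔬.G0 U ∘ₗ (𝔬.Tpi U + 𝔬.T2 U)) ∘ₗ (𝔬.G1 U ∘ₗ 𝔬.Dv U)) ∘ₗ
          (𝔬.R U ∘ₗ 𝔬.Dvstar U ∘ₗ 𝔬.G1 U ∘ₗ LinearMap.id)) := by
    rw [comp_fix_left_right (𝔬.D U) (𝔬.Dv U) hfix1, LinearMap.add_comp]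
  have hB := hB1.add hB2
  rw [← eB] at hB
  -- (d) TERM C = (∇G₁Q*)((QG₁Q*)⁻¹QG₁) through the sup classes Z², Z⁰
  have hQG : HasMaj (cNorm R₀ H₀ 𝔬.blk hG.lenle 0) (cNorm R₀ H₀ 𝔬.blkZ hG.lenle 2) (𝔬.Q U ∘ₗ (𝔬.G1 U ∘ₗ LinearMap.id))
      (fun a b => (cNorm R₀ H₀ 𝔬.blk hG.lenle 2 (X := X)).κ * B₃ * (B₀ * (1 - θ * c)⁻¹) * c *
        Real.exp (-((ρ' + 2 * σ) * g.dist a b))) :=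
    hasMaj_comp_exp htri hG.dnn hrow hB₃ hA₁ (by linarith) (by linarith) (by linarith) hL.q2 hG1
  simp only [cNorm_κ, one_mul] at hQG
  have hK₁ : 0 ≤ B₃ * (B₀ * (1 - θ * c)⁻¹) * c := mul_nonneg (mul_nonneg hB₃ hA₁) hc
  have hCQG : HasMaj (cNorm R₀ H₀ 𝔬.blk hG.lenle 0) (cNorm R₀ H₀ 𝔬.blkZ hG.lenle 0)
      (𝔬.C1 U ∘ₗ (𝔬.Q U ∘ₗ (𝔬.G1 U ∘ₗ LinearMap.id)))
      (fun a b => (cNorm R₀ H₀ 𝔬.blkZ hG.lenle 2 (X := Z)).κ * B₃ * (B₃ * (B₀ * (1 - θ * c)⁻¹) * c) * c *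
        Real.exp (-((ρ' + σ) * g.dist a b))) :=
    hasMaj_comp_exp htri hG.dnn hrow hB₃ hK₁ (by linarith) (by linarith) (by linarith) hL.c1_2 hQG
  simp only [cNorm_κ, one_mul] at hCQG
  have hD1Q : HasMaj (cNorm R₀ H₀ 𝔬.blkZ hG.lenle 0) (cNorm R₀ H₀ 𝔬.blkY hG.lenle 1) (𝔬.D U ∘ₗ 𝔬.G1 U ∘ₗ 𝔬.Qstar U)
      (fun y y' => (B₃ + θ' * (B₃ * (1 - θ * c)⁻¹) * c) * Real.exp (-((ρ' + σ) * g.dist y y'))) :=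
    hasMaj_left_right hG hrow hθ' hB₃ hA₃ (by linarith) (by linarith) (by linarith) (by linarith) hLS.stepD1 hLD.dgQs hGQ
      hfix1
  have hBθ : 0 ≤ B₃ + θ' * (B₃ * (1 - θ * c)⁻¹) * c := add_nonneg hB₃ hθA₃
  have hK₂ : 0 ≤ B₃ * (B₃ * (B₀ * (1 - θ * c)⁻¹) * c) * c := mul_nonneg (mul_nonneg hB₃ hK₁) hc
  have hC : HasMaj (cNorm R₀ H₀ 𝔬.blk hG.lenle 0) (cNorm R₀ H₀ 𝔬.blkY hG.lenle 1)
      ((𝔬.D U ∘ₗ 𝔬.G1 U ∘ₗ 𝔬.Qstar U) ∘ₗ (𝔬.C1 U ∘ₗ (𝔬.Q U ∘ₗ (𝔬.G1 U ∘ₗ LinearMap.id))))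
      (fun y y' => (cNorm R₀ H₀ 𝔬.blkZ hG.lenle 0 (X := Z)).κ * (B₃ + θ' * (B₃ * (1 - θ * c)⁻¹) * c) *
        (B₃ * (B₃ * (B₀ * (1 - θ * c)⁻¹) * c) * c) * c * Real.exp (-(ρ' * g.dist y y'))) :=
    hasMaj_comp_exp htri hG.dnn hrow hBθ hK₂ hρ' (by linarith) le_rfl hD1Q hCQG
  simp only [cNorm_κ, one_mul] at hC
  -- (e) assembling (3.153) differentiated on the left
  have h := ((hD1.of_rate_le hG.dnn hCL (by linarith : ρ' ≤ ρ)).sub hB).sub hC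
  rw [← D_GG_eq hI] at h
  have hC0 : 0 ≤ constD313 (B₀ + θ' * (B₀ * (1 - θ * c)⁻¹) * c) θ' (B₀ * (1 - θ * c)⁻¹) (B₃ * (1 - θ * c)⁻¹) B₃ bH.κ c :=
    constD313_nonneg hCL hθ' hA₁ hA₃ hB₃ bH.κ_nonneg hc
  have h2 : HasMaj (cNorm R₀ H₀ 𝔬.blk hG.lenle 0) (cNorm R₀ H₀ 𝔬.blkY hG.lenle 1) (𝔬.D U ∘ₗ 𝔬.GG U)
      (fun a b => constD313 (B₀ + θ' * (B₀ * (1 - θ * c)⁻¹) * c) θ' (B₀ * (1 - θ * c)⁻¹) (B₃ * (1 - θ * c)⁻¹) B₃ bH.κ c *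
        Real.exp (-(ρ' * g.dist a b))) :=
    h.mono fun a b => le_of_eq (by simp only [constD313, toB6_dist]; ring)
  have h' := hasMajorantHom_of_hasMaj_cNorm hG (fun a b => mul_nonneg hC0 (Real.exp_nonneg _)) h2
  refine hasMajorantHom_mono (g := toB6 g R₀ H₀) 𝔬.blk 𝔬.blkY h' fun a b => le_of_eq ?_
  simp only [wt, pow_zero, pow_one, inv_one, mul_one]
  ring

end OneMember

end

end Literature.MathematicalPhysics.QuantumFieldTheory.Balaban1983to89.B9Thm313WholeLeft
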